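import Literature.NumberTheory.EllipticCurves.ComplexMultiplicationJInvariantProofs
import Literature.NumberTheory.EllipticCurves.HeegnerPointsClassesProofs
import Literature.NumberTheory.EllipticCurves.ModularCurveKleinJ
import Literature.NumberTheory.QuadraticFields.BinaryQuadraticFormsClassNumber
import HarnessLib

/-!
# Every singular modulus `j(τ_Q)` of discriminant `D` is a root of the class polynomial `H_D`
# (discharge of `isRoot_classPolynomial`; Cox, *Primes of the form x² + ny²*, Thm. 2.8, §13.A)

Topic `NumberTheory/EllipticCurves`; proof sibling of
`Literature/NumberTheory/EllipticCurves/ComplexMultiplicationJInvariantProofs.lean`, which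
decomposes the named fact `Literature.NumberTheory.EllipticCurves.j_mem_cmJInvariants_of_hasCM`
(`E/ℚ` with CM `⟹ j(E)` is one of the thirteen rational CM `j`-invariants; a leaf of the
reduction of `bsdRankFormula_of_hasCM_of_L_one_ne_zero` and `finite_point_of_hasCM_of_L_one_ne_zero`
to Coates–Wiles 1977, Thm. 1) into five named facts.  One of them is

* `Literature.NumberTheory.EllipticCurves.isRoot_classPolynomial` : for every primitive positive
  definite form `Q = (a, b, c)` of discriminant `D = b² − 4ac < 0`, the singular modulus
  `j(τ_Q) = j(ℤτ_Q + ℤ)`, `τ_Q = (−b + √D)/(2a)` (`formJ Q`), is a root of the class polynomial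
  `H_D = ∏_{Q' reduced of discriminant D} (X − j(τ_{Q'}))` (`classPolynomial D`) — Cox, §13.A,
  the consequence of Prop. 13.2 ("`H_𝒪(X)` is the minimal polynomial of `j(𝔞)`, where `𝔞` is any
  proper fractional `𝒪`-ideal"), read through Thm. 7.7 (forms ↔ proper ideals).

With `classPolynomial` *defined* as the product over the reduced forms, this statement is
elementary and is **proved here** (`isRoot_classPolynomial_holds`), along Cox's route
Thm. 2.8 + (7.8) + Thm. 11.2:

1. **Gauss reduction** (Cox, Thm. 2.8, existence half): `Q` is properly equivalent to a reduced
   form `Q'` of the same discriminant — proved in the tree as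
   `Literature.NumberTheory.QuadraticFields.Quadratic.BinQF.exists_properEquiv_isReduced`
   (`Literature/NumberTheory/QuadraticFields/BinaryQuadraticFormsClassNumber.lean`, on the record
   type `BinQF`; `isRoot_classPolynomial` is stated on triples `ℤ × ℤ × ℤ`, and the two encodings
   of `IsPrimitive` / `IsReduced` agree definitionally: `isPrimitive_iff_binQF`,
   `isReduced_iff_binQF`);
2. **the CM points of properly equivalent forms are `SL₂(ℤ)`-equivalent**: if `Q' = Q·M`,
   `M = (p q; r s) ∈ SL₂(ℤ)` (`Q'(x, y) = Q(px + qy, rx + sy)`, `BinQF.act`), then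
   `τ_{Q'} = M⁻¹ · τ_Q` — the tree's `Literature.NumberTheory.EllipticCurves.sl2_smul_heegnerTau`
   (`HeegnerPointsClassesProofs.lean`: `g · τ_Q = τ_{Q ∘ g⁻¹}`) applied to `g = M⁻¹ = (s −q; −r p)`
   (`exists_sl2_smul_heegnerTau_eq_heegnerTau_act`; Cox, §7.B, proof of Thm. 7.7, eq. (7.8), and
   Exercise 11.5: "if `f(x, y)` and `g(x, y)` are properly equivalent, then `τ` and `τ'` are
   `SL(2, ℤ)`-equivalent");
3. **`j(τ)` is `SL₂(ℤ)`-invariant** (Cox, Thm. 11.2(i); in the tree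
   `Literature.NumberTheory.EllipticCurves.ModularForms.kleinJ_smul` with `kleinJ_eq_periodPair_j`),
   so `j(τ_Q) = j(τ_{Q'})` (`formJ_eq_of_properEquiv`);
4. `Q'` is one of the factors of `H_D` (`mem_reducedForms_iff`), so `H_D(j(τ_Q)) = 0`.

Everything in this file is proved; no new definitions.  After it the trust base of
`j_mem_cmJInvariants_of_hasCM` (`j_mem_cmJInvariants_of_hasCM_of_facts`), hence of
`finite_point_of_hasCM_of_L_one_ne_zero` and `bsdRankFormula_of_hasCM_of_L_one_ne_zero` on the
class-number side, is: `periodPair_hasCM_of_hasCM`, `irreducible_classPolynomial`,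
`mem_classNumberOneDiscrs_of_classNumber_eq_one` (Baker–Heegner–Stark) and the singular moduli
`singularModuli_nonmaximalOrders` (four non-maximal rows) and `singularModuli_classNumberOne_three`
(rows `d = −43, −67, −163`, shared with the Coates–Wiles side).

## Mathlib / tree search

Mathlib (pin v4.32.0) has the `SL(2, ℤ)`-action on `ℍ` and level-one modular forms, but no binary
quadratic forms and no CM points (`lean search` for `heegnerTau`, `ProperEquiv`, `reducedForms`,
`classPolynomial`: tree only).  From the tree we use `heegnerTau` (`HeegnerPoints.lean`),
`sl2_smul_heegnerTau` (`HeegnerPointsClassesProofs.lean`), `formJ`, `formJ_def`,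
`classPolynomial`, `isRoot_classPolynomial` (`ComplexMultiplicationJInvariantProofs.lean`),
`kleinJ_smul`, `kleinJ_eq_periodPair_j` (`ModularCurveKleinJ.lean`),
`BinQF.exists_properEquiv_isReduced`, `BinQF.IsPosPrim`, `BinQF.ProperEquiv`, `BinQF.act`
(`BinaryQuadraticFormsClassNumber.lean`), and `reducedForms`, `mem_reducedForms_iff`,
`isReduced_iff` (`ReducedForms.lean`); nothing is restated.

## References

* D. A. Cox, *Primes of the form x² + ny²*, 2nd ed., Wiley 2013: §2.A Thm. 2.8 (reduction, PDF
  p. 53 of the held copy); §7.B Thm. 7.7 and its proof, eq. (7.8) (PDF pp. 150–151); §11.A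
  Thm. 11.2 (`j` is `SL(2, ℤ)`-invariant) and Exercise 11.5; §13.A Prop. 13.2 and the following
  paragraph (PDF pp. 288–289). [Cox2013]
-/

noncomputable section

open scoped UpperHalfPlane MatrixGroups
open Complex Polynomial Literature.NumberTheory.QuadraticFields.BinaryQuadraticForm
  Literature.NumberTheory.QuadraticFields.Quadratic

namespace Literature.NumberTheory.EllipticCurves

/-! ### CM points of properly equivalent forms are `SL₂(ℤ)`-equivalent -/

/-- **Equivariance of `Q ↦ τ_Q` under proper equivalence.**  Let `f = (a, b, c)` be positive
definite (`a > 0`, `disc f < 0`) and `M = (p q; r s) ∈ SL₂(ℤ)`, and let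
`f·M = f(px + qy, rx + sy)` (`BinQF.act f p q r s`).  Then `τ_{f·M} = γ · τ_f` for
`γ = M⁻¹ = (s −q; −r p) ∈ SL₂(ℤ)`, by `sl2_smul_heegnerTau` (`γ · τ_f = τ_{f ∘ γ⁻¹}` and
`f ∘ γ⁻¹ = f ∘ M = f·M`).  Cox, *Primes of the form x² + ny²*, §7.B, proof of Thm. 7.7
(eq. (7.8) and the change of basis by `(p q; r s)`), §11.A Exercise 11.5.
[cite: Cox2013, §7.B Thm. 7.7 (proof, eq. (7.8)) and §11.A Exercise 11.5] -/
theorem exists_sl2_smul_heegnerTau_eq_heegnerTau_act (f : BinQF) (ha : 0 < f.a)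
    (hdisc : f.disc < 0) {p q r s : ℤ} (hdet : p * s - q * r = 1) :
    ∃ γ : SL(2, ℤ), γ • heegnerTau (f.a, f.b, f.c) =
      heegnerTau ((f.act p q r s).a, (f.act p q r s).b, (f.act p q r s).c) := by
  have hfd : f.b ^ 2 - 4 * f.a * f.c < 0 := hdisc
  let γ : SL(2, ℤ) := ⟨!![s, -q; -r, p], by rw [Matrix.det_fin_two_of]; linear_combination hdet⟩
  have h00 : γ 0 0 = s := rfl
  have h01 : γ 0 1 = -q := rfl
  have h10 : γ 1 0 = -r := rfl
  have h11 : γ 1 1 = p := rfl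
  refine ⟨γ, ?_⟩
  rw [sl2_smul_heegnerTau γ ha hfd, h00, h01, h10, h11]
  congr 1
  simp only [BinQF.act, Prod.mk.injEq]
  exact ⟨by ring, by ring, by ring⟩

/-! ### `j(τ_Q)` is a class invariant -/

/-- **`j(τ_{f·M}) = j(τ_f)`** for `M = (p q; r s) ∈ SL₂(ℤ)` and `f` positive definite: the CM
points differ by an element of `SL₂(ℤ)` (`exists_sl2_smul_heegnerTau_eq_heegnerTau_act`), and
`j(γτ) = j(τ)` (`Literature.NumberTheory.EllipticCurves.ModularForms.kleinJ_smul`, Cox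
Thm. 11.2(i)), with `j(ℤτ + ℤ) = j(τ)` (`kleinJ_eq_periodPair_j`). [cite: Cox2013, §11.A Thm. 11.2] -/
theorem formJ_eq_formJ_act (f : BinQF) (ha : 0 < f.a) (hdisc : f.disc < 0) {p q r s : ℤ}
    (hdet : p * s - q * r = 1) :
    formJ (f.a, f.b, f.c) = formJ ((f.act p q r s).a, (f.act p q r s).b, (f.act p q r s).c) := by
  obtain ⟨γ, hγ⟩ := exists_sl2_smul_heegnerTau_eq_heegnerTau_act f ha hdisc hdet
  rw [formJ_def, formJ_def, ← hγ, ← ModularForms.kleinJ_eq_periodPair_j,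
    ← ModularForms.kleinJ_eq_periodPair_j, ModularForms.kleinJ_smul]

/-- **The singular modulus `j(τ_Q)` only depends on the proper equivalence class of `Q`**
(Cox, §7.B–§11.A: properly equivalent forms have `SL(2, ℤ)`-equivalent roots, Exercise 11.5,
and `j` is `SL(2, ℤ)`-invariant, Thm. 11.2; equivalently, via Thm. 7.7, `j(𝔞)` depends only on
the ideal class of `𝔞`, §10.C). [cite: Cox2013, §11.A Thm. 11.2 and Exercise 11.5] -/
theorem formJ_eq_of_properEquiv {f g : BinQF} (ha : 0 < f.a) (hdisc : f.disc < 0)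
    (h : f.ProperEquiv g) : formJ (f.a, f.b, f.c) = formJ (g.a, g.b, g.c) := by
  obtain ⟨p, q, r, s, hdet, rfl⟩ := h
  exact formJ_eq_formJ_act f ha hdisc hdet

/-! ### The two encodings of forms agree -/

/-- The primitivity predicates on triples (`ReducedForms.lean`, `Int.gcd`) and on `BinQF`
(`BinaryQuadraticFormsClassNumber.lean`, `Nat.gcd` of absolute values) agree. [folklore] -/
theorem isPrimitive_iff_binQF (Q : ℤ × ℤ × ℤ) :
    IsPrimitive Q ↔ (BinQF.mk Q.1 Q.2.1 Q.2.2).IsPrimitive :=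
  Iff.rfl

/-- The reducedness predicates on triples and on `BinQF` agree (both are Cox's (2.7)).
[folklore] -/
theorem isReduced_iff_binQF (Q : ℤ × ℤ × ℤ) :
    IsReduced Q ↔ (BinQF.mk Q.1 Q.2.1 Q.2.2).IsReduced :=
  isReduced_iff Q.1 Q.2.1 Q.2.2

/-! ### Discharge of `isRoot_classPolynomial` -/

/-- **Every singular modulus of discriminant `D` is a root of `H_D`** — discharge of the named
fact `isRoot_classPolynomial` (Cox, *Primes of the form x² + ny²*, §13.A, consequence of
Prop. 13.2 with Thm. 7.7(i)): for a primitive positive definite form `Q` of discriminant `D < 0`,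
`H_D(j(τ_Q)) = 0`, where `H_D = ∏_{Q' reduced} (X − j(τ_{Q'}))`.  Proof: `Q ~ Q'` with `Q'`
reduced (Cox Thm. 2.8, `BinQF.exists_properEquiv_isReduced`), `j(τ_Q) = j(τ_{Q'})`
(`formJ_eq_of_properEquiv`), and `X − j(τ_{Q'})` is a factor of `H_D`.
[cite: Cox2013, §13.A Prop. 13.2 (consequence) with Thm. 2.8] -/
theorem isRoot_classPolynomial_holds : isRoot_classPolynomial := by
  intro Q hQ1 hprim hdisc
  set f : BinQF := ⟨Q.1, Q.2.1, Q.2.2⟩ with hf_def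
  have hf : f.IsPosPrim (discr Q) := ⟨rfl, hQ1, (isPrimitive_iff_binQF Q).1 hprim⟩
  obtain ⟨g, hfg, hred⟩ := BinQF.exists_properEquiv_isReduced hdisc hf
  have hg : g.IsPosPrim (discr Q) := hfg.isPosPrim hdisc hf
  have hmem : (g.a, g.b, g.c) ∈ reducedForms (discr Q) :=
    (mem_reducedForms_iff hdisc).2
      ⟨hg.disc_eq, hg.a_pos, (isPrimitive_iff_binQF (g.a, g.b, g.c)).2 hg.primitive,
        (isReduced_iff_binQF (g.a, g.b, g.c)).2 hred⟩
  have hj : formJ Q = formJ (g.a, g.b, g.c) :=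
    formJ_eq_of_properEquiv (f := f) hQ1 hdisc hfg
  rw [classPolynomial, Polynomial.isRoot_prod]
  exact ⟨(g.a, g.b, g.c), hmem, by simp [hj]⟩

end Literature.NumberTheory.EllipticCurves

end
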